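import Summits.NavierStokesRegularity.NavierStokesRegularity.Theses.ExtremalEnstrophy
import Literature.Analysis.FluidPDE.NSQuasipotential
import HarnessLib.Audit

/-!
# Birth skeleton (BC3) of the crux `ExtremalEnstrophy.CompactnessDichotomy` — line `birth`

Crux item `stmt-NavierStokesRegularity-18664` (decl
`Summit.NavierStokesRegularity.NavierStokesRegularity.Theses.ExtremalEnstrophy.CompactnessDichotomy`,
crux V1, rank 3, of route `route-NavierStokesRegularity-ExtremalEnstrophy`, re-audit bin HONEST).
Tree path `Cruxes/CompactnessDichotomy/Lines/birth.lean`; registrar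
`planner-skel-stmt-NavierStokesRegularity-18664-0`, 2026-08-17. Nothing here is new mathematics:
the file types the route header's OWN layer-1 cut of V1 (TWO-LAYER PLAN: "CompactnessDichotomy ⇐
ProfileExtraction → CompactAttained → CompactnessDichotomy") as two named stubs plus a proved
seam. (The opening planner's pre-birth sketch `bc/CompactnessDichotomy_birth.lean`, attached as
item evidence, is not readable from registrar seats; this skeleton is re-typed from the route file.)

THE CRUX (V1, soft dichotomy of the extreme-enstrophy value function). For `ν > 0`, budgets
`E, Z > 0`, horizon `T > 0` with `𝒵 = maxEnstrophy ν E Z T < ∞`: EITHER the maximal enstrophy is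
attained (`IsMaxEnstrophyAttained ν E Z T`), OR there is a uniform gain `γ₀ > 0` such that for
every `ε > 0` some maximising sequence is an `ε`-profile-split sequence
(`IsProfileSplitSequence ν E Z T ε D`, observed enstrophies `→ 𝒵`) all of whose profiles have
enstrophy `≤ Z − γ₀`.

THE CUT (Lions' concentration–compactness trichotomy for the maximisation problem, run on the
DATA of a maximising sequence; two named stubs, one proved seam):

* `stub_profileDichotomy` (ProfileExtraction; size L; functional analysis, no dynamics). Every
  maximising sequence of admissible trajectories (Leray–Hopf trajectories with
  data of energy `≤ E`, enstrophy `≤ Z`, observation times in the closed window, observed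
  enstrophies `→ 𝒵`) has, after extraction, EITHER data compact in `Ḣ¹` modulo translations —
  cores `x n` and a limit datum `ψ ∈ L²`, weakly divergence free, of energy `≤ E` and enstrophy
  `≤ Z`, with `‖∇(u (σ n) 0 (· + x n) − ψ)‖₂² → 0` — OR a uniform
  gain: `γ₀ > 0` such that for every `ε > 0` a subsequence is an `ε`-profile-split sequence whose
  profiles all have enstrophy `≤ Z − γ₀`. Route: the `H¹(ℝ³)` profile decomposition modulo
  translations of the bounded sequence of data (Gérard 1998, Thm 1.1; Hmidi–Keraani 2005,
  Prop. 3.1; Lions 1984, Lemma I.1 for `L³`-smallness of remainders, `2 < 3 < 6`): if NO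
  uniform gain exists then for every `k` an `ε_k`-split along a nested subsequence has a profile
  `φ_k` with `‖∇φ_k‖₂² > Z − 1/k`, so by budget orthogonality (`Σ‖∇φʲ‖² + limsup‖∇rₙ‖² ≤ Z`,
  frames drifting apart) the data are eventually `O(1/√k)`-close in `Ḣ¹` to the translation
  orbit of `φ_k`; a diagonal Cauchy argument modulo translations (profiles bounded in `L²` by `E`,
  weak limits weakly divergence free, budgets by lower semicontinuity) produces `ψ` and the
  compact branch. Otherwise the gain branch holds (VANISHING is the case `J = 0`: remainder
  `L³`-null, the profile condition vacuous). Why it might fail: only through the bookkeeping of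
  the tree's `IsProfileSplitSequence` shape (pointwise decomposition, weak `L²`-orthogonality of
  the remainder in every frame, budget orthogonality as typed) and the existence of such splits
  for bounded `H¹` sequences of divergence-free data in exactly that shape.
* `stub_compactAttained` (CompactAttained; size L; the Navier–Stokes dynamics). At a FINITE level,
  a maximising sequence whose data are compact in `Ḣ¹` modulo translations (limit `ψ` within
  budget) yields attainment: the flow `v` from `ψ` is strong on `[0, T]` (finite level ⇒ enstrophy
  `≤ 𝒵 < ∞` along admissible flows, `H¹` local theory FujitaKato1964 and continuation), the
  translated flows `u (n) (·, · + x n)` are `Ḣ¹`-close to `v` uniformly on the window (stability of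
  the strong flow under `Ḣ¹`-small, `L²`-bounded perturbations: Gronwall on `‖∇w‖₂²` with
  coefficients `‖∇v‖₃², ‖v‖²_∞ ∈ L¹_t`), so `‖∇v(tₙ)‖₂² → 𝒵`; `tₙ → t* ∈ [0, T]` (closed window) and
  continuity of `t ↦ ‖∇v(t)‖₂²` on `[0, T]` give `‖∇v(t*)‖₂² = 𝒵`, `v` being a Leray–Hopf trajectory
  on some `[0, T'')`, `T'' > T`. Why it might fail: the tree's `IsLerayHopfOn`/weak-gradient
  infrastructure must carry `H¹` strong solutions, weak–strong uniqueness and `Ḣ¹`-stability —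
  heavy but standard (RobinsonRodrigoSadowski2016 Ch. 6–8).
* `exists_maximisingSeq` (PROVED seam, not a stub): at every level with `T ≥ 0` a maximising
  sequence exists — the rest state is an admissible trajectory (`isLerayHopfOn_zero`,
  `hasWeakGradient_zero`), so `enstrophyValues` is nonempty, and `exists_seq_tendsto_sSup` in
  `ℝ≥0∞` does the rest. Both notions (maximising sequence; `Ḣ¹`-compactness modulo translations)
  are written INLINE over tree declarations — the file declares no `Prop` of its own.
* `CompactnessDichotomy_of_hyps : S₁ → S₂ → CompactnessDichotomy` (the composition over the stub
  STATEMENTS, real proof, closed): take a maximising sequence (seam), apply the dichotomy; the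
  compact branch feeds `stub_compactAttained` along the subsequence, the gain branch IS the second
  disjunct once the observed enstrophies of `D` are identified with a subsequence of a convergent
  sequence. `CompactnessDichotomy_of : CompactnessDichotomy` applies it to the two registered
  stubs BY NAME (the only other theorem of the file concluding the crux).

BC3 probes (registrar folder `bc/probe_*.lean`, stub statements restated, birth file NOT
imported): for each stub `S`, `S → CompactnessDichotomy` and `S → NavierStokesRegularity` by
`first | exact? | simpa | aesop` (folded and unfolded batteries) FAIL — see `Lines/birth.md`.

Disproof used: none exists for this crux (`ledger crux ls stmt-NavierStokesRegularity-18664`: no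
workfiles before this one; no `Disproof.lean`, no `Negative/` lemma). `ledger negatives --problem
NavierStokesRegularity` (5 refuted statements, 2026-08-17): none concerns enstrophy maximisation,
profile decompositions or attainment; neither stub is an instance of a refuted statement.
-/

noncomputable section

-- the summit and its single sub-problem share the name `NavierStokesRegularity` (D-0017 nested layout)
set_option linter.dupNamespace false
set_option linter.unusedVariables false

namespace Summit.NavierStokesRegularity.NavierStokesRegularity.Cruxes.CompactnessDichotomy.Birth

open Set Filter Topology MeasureTheory Function
open scoped ENNReal NNReal
open Literature.Analysis.FluidPDE
open Summit.NavierStokesRegularity.NavierStokesRegularity.Theses.ExtremalEnstrophy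

local notation "ℝ³" => EuclideanSpace ℝ (Fin 3)

/-! ## Conventions of the line (no new declarations)

A **maximising sequence** at level `(E, Z, T)` is spelled out by five hypotheses, always in this
order: `(T', u, t)` with `∀ n, IsLerayHopfTrajectory ν (T' n) (u n)` (admissible Leray–Hopf
trajectories), `∀ n, eEnergy (u n 0) ≤ E`, `∀ n, eWeakGradL2Sq (u n 0) ≤ Z` (data within budget),
`∀ n, 0 ≤ t n ∧ t n ≤ T ∧ t n < T' n` (observation times in the closed window and the lifespan),
`Tendsto (fun n => eWeakGradL2Sq (u n (t n))) atTop (𝓝 (maxEnstrophy ν E Z T))` (Kang–Yun–Protas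
2020, §2 Problem 1). **Compactness of the data in `Ḣ¹` modulo translations** (Lions 1984, Lemma
I.1, the compactness alternative; the one-profile case of Gérard 1998, Thm 1.1) is spelled out by:
cores `x : ℕ → ℝ³`, a limit datum `ψ` with `MemLp ψ 2 volume`, `IsWeaklyDivFree ψ`,
`eEnergy ψ ≤ E`, `eWeakGradL2Sq ψ ≤ Z`, and
`Tendsto (fun n => eWeakGradL2Sq (fun y => u n 0 (y + x n) - ψ y)) atTop (𝓝 0)` — no
`L²`-convergence is asserted (translating mass may escape weakly). Both are written INLINE over
the tree's declarations so that the registered signatures are the real statements.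
-/

/-! ## Stubs -/

/-- **stub 1 — `stub_profileDichotomy` (ProfileExtraction; size L; OPEN in the tree, a theorem in
print).** At a finite level `(E, Z, T)`, `ν, E, Z, T > 0`, every maximising sequence `(T', u, t)`
satisfies the profile dichotomy: EITHER a subsequence `σ` of its data is compact in `Ḣ¹` modulo
translations `x n` with a limit datum `ψ` within budget (`L²`, weakly divergence free, energy
`≤ E`, enstrophy `≤ Z`, `‖∇(u (σ n) 0 (· + x n) − ψ)‖₂² → 0`), OR there is a uniform gain `γ₀ > 0`
such that for every precision `ε > 0` some subsequence is an `ε`-profile-split sequence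
(`IsProfileSplitSequence ν E Z T ε D` with `D.u n = u (σ n)`, `D.t n = t (σ n)`) all of whose
profiles have enstrophy `≤ Z − γ₀`. Route: `H¹(ℝ³)` profile decomposition modulo translations of
the data (bounded in `H¹`: energy `≤ E`, enstrophy `≤ Z`), remainders `L³`-small (`2 < 3 < 6`),
`Ḣ¹`- and `L²`-orthogonality; if no uniform gain exists, splits along nested subsequences carry
profiles `φ_k` with `‖∇φ_k‖₂² > Z − 1/k`, budget orthogonality makes the data eventually
`O(1/√k)`-close in `Ḣ¹` to the translation orbit of `φ_k`, and a diagonal Cauchy argument modulo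
translations gives `ψ` and the compact branch; otherwise the gain branch (vanishing = `J = 0`);
profiles are weak limits of translated data, hence `L²`, weakly divergence free, energy `≤ E`.
[cite: Gerard1998, Thm 1.1; Lions1984, Lemma I.1; HmidiKeraani2005, Prop. 3.1; Gallagher2001,
Thm 1] [status: open] -/
theorem stub_profileDichotomy :
    ∀ ν : ℝ, 0 < ν → ∀ (E Z : ℝ≥0) (T : ℝ), 0 < E → 0 < Z → 0 < T →
      maxEnstrophy ν E Z T < ⊤ →
      ∀ (T' : ℕ → ℝ) (u : ℕ → ℝ → ℝ³ → ℝ³) (t : ℕ → ℝ),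
        (∀ n, IsLerayHopfTrajectory ν (T' n) (u n)) → (∀ n, eEnergy (u n 0) ≤ E) →
        (∀ n, eWeakGradL2Sq (u n 0) ≤ Z) → (∀ n, 0 ≤ t n ∧ t n ≤ T ∧ t n < T' n) →
        Tendsto (fun n => eWeakGradL2Sq (u n (t n))) atTop (𝓝 (maxEnstrophy ν E Z T)) →
        (∃ (σ : ℕ → ℕ) (x : ℕ → ℝ³) (ψ : ℝ³ → ℝ³), StrictMono σ ∧ MemLp ψ 2 volume ∧
            IsWeaklyDivFree ψ ∧ eEnergy ψ ≤ E ∧ eWeakGradL2Sq ψ ≤ Z ∧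
            Tendsto (fun n => eWeakGradL2Sq (fun y => u (σ n) 0 (y + x n) - ψ y)) atTop (𝓝 0)) ∨
        (∃ γ₀ : ℝ≥0, 0 < γ₀ ∧ ∀ ε : ℝ, 0 < ε →
            ∃ (J : ℕ) (D : ProfileSplitData J) (σ : ℕ → ℕ), StrictMono σ ∧
              IsProfileSplitSequence ν E Z T ε D ∧ (∀ n, D.u n = u (σ n) ∧ D.t n = t (σ n)) ∧
              ∀ j, eWeakGradL2Sq (D.φ j) + γ₀ ≤ Z) := by
  sorry

/-- **stub 2 — `stub_compactAttained` (CompactAttained; size L; OPEN in the tree).** At a FINITE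
level `(E, Z, T)`, `ν, E, Z, T > 0`, `maxEnstrophy ν E Z T < ∞`: if a maximising sequence
`(T', u, t)` has data compact in `Ḣ¹` modulo translations `x n` with limit datum `ψ` within
budget (`L²`, weakly divergence free, energy `≤ E`, enstrophy `≤ Z`,
`‖∇(u n 0 (· + x n) − ψ)‖₂² → 0`), then the maximal enstrophy is attained
(`IsMaxEnstrophyAttained ν E Z T`). Route: the flow `v` from `ψ` is a Leray–Hopf trajectory,
strong on `[0, T]` because admissible flows within budget have enstrophy `≤ 𝒵 < ∞` on the window
(`eWeakGradL2Sq_le_maxEnstrophy`) and `H¹` strong solutions continue while the enstrophy is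
bounded (Fujita–Kato); translation invariance and `Ḣ¹`-stability of the strong flow under
`Ḣ¹`-small, `L²`-bounded perturbations of the datum (Gronwall on `‖∇w‖₂²` with coefficients
`‖∇v‖₃², ‖v‖²_∞ ∈ L¹_t`) give `‖∇v(t n)‖₂² − ‖∇u n (t n)‖₂² → 0`, so `‖∇v(t n)‖₂² → 𝒵`; extract
`t n → t* ∈ [0, T]` and use continuity of `t ↦ ‖∇v(t)‖₂²` on the closed window (strong solution
from an `H¹` datum, continuous at `t = 0⁺` too); `v` lives past `T`.
[cite: FujitaKato1964, Thm 1; Kato1984; RobinsonRodrigoSadowski2016, Thm 6.8 and Ch. 8;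
KangYunProtas2020, §2] [status: open] -/
theorem stub_compactAttained :
    ∀ ν : ℝ, 0 < ν → ∀ (E Z : ℝ≥0) (T : ℝ), 0 < E → 0 < Z → 0 < T →
      maxEnstrophy ν E Z T < ⊤ →
      ∀ (T' : ℕ → ℝ) (u : ℕ → ℝ → ℝ³ → ℝ³) (t : ℕ → ℝ) (x : ℕ → ℝ³) (ψ : ℝ³ → ℝ³),
        (∀ n, IsLerayHopfTrajectory ν (T' n) (u n)) → (∀ n, eEnergy (u n 0) ≤ E) →
        (∀ n, eWeakGradL2Sq (u n 0) ≤ Z) → (∀ n, 0 ≤ t n ∧ t n ≤ T ∧ t n < T' n) →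
        Tendsto (fun n => eWeakGradL2Sq (u n (t n))) atTop (𝓝 (maxEnstrophy ν E Z T)) →
        MemLp ψ 2 volume → IsWeaklyDivFree ψ → eEnergy ψ ≤ E → eWeakGradL2Sq ψ ≤ Z →
        Tendsto (fun n => eWeakGradL2Sq (fun y => u n 0 (y + x n) - ψ y)) atTop (𝓝 0) →
        IsMaxEnstrophyAttained ν E Z T := by
  sorry

/-! ## Proved seam -/

/-- The rest state, seen as a time-dependent field, is an admissible trajectory on `[0, S)` for
every `S > 0` (`isLerayHopfOn_zero`; the zero datum is weakly divergence free). [folklore] -/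
theorem isLerayHopfTrajectory_zero (ν : ℝ) {S : ℝ} (hS : 0 < S) :
    IsLerayHopfTrajectory ν S (0 : ℝ → ℝ³ → ℝ³) where
  pos := hS
  divFree := fun θ _ => by simp
  lerayHopf := isLerayHopfOn_zero S ν

/-- The observed enstrophies at any level with `T ≥ 0` form a nonempty set: the rest state
observed at time `0` contributes the value `‖∇0‖₂²`. [folklore] -/
theorem enstrophyValues_nonempty (ν : ℝ) (E Z : ℝ≥0) {T : ℝ} (hT : 0 ≤ T) :
    (enstrophyValues ν E Z T).Nonempty := by
  refine ⟨eWeakGradL2Sq ((0 : ℝ → ℝ³ → ℝ³) 0), T + 1, 0, 0,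
    isLerayHopfTrajectory_zero ν (by linarith), ?_, ?_, le_rfl, hT, by linarith, rfl⟩
  · simp [eEnergy]
  · calc eWeakGradL2Sq ((0 : ℝ → ℝ³ → ℝ³) 0)
        ≤ ∫⁻ x, ENNReal.ofReal (frobeniusNormSq ((fun _ : ℝ³ => (0 : ℝ³ →L[ℝ] ℝ³)) x)) :=
          eWeakGradL2Sq_le_of_hasWeakGradient (hasWeakGradient_zero (E := ℝ³))
      _ ≤ Z := by simp

/-- **Existence of maximising sequences** (the seam of the line): at every level with `T ≥ 0`
there is a maximising sequence of admissible trajectories — `enstrophyValues` is nonempty and a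
supremum in `ℝ≥0∞` is the limit of a sequence of members (`exists_seq_tendsto_sSup`). [folklore] -/
theorem exists_maximisingSeq (ν : ℝ) (E Z : ℝ≥0) {T : ℝ} (hT : 0 ≤ T) :
    ∃ (T' : ℕ → ℝ) (u : ℕ → ℝ → ℝ³ → ℝ³) (t : ℕ → ℝ),
      (∀ n, IsLerayHopfTrajectory ν (T' n) (u n)) ∧ (∀ n, eEnergy (u n 0) ≤ E) ∧
      (∀ n, eWeakGradL2Sq (u n 0) ≤ Z) ∧ (∀ n, 0 ≤ t n ∧ t n ≤ T ∧ t n < T' n) ∧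
      Tendsto (fun n => eWeakGradL2Sq (u n (t n))) atTop (𝓝 (maxEnstrophy ν E Z T)) := by
  obtain ⟨z, -, hz, hmem⟩ :=
    exists_seq_tendsto_sSup (enstrophyValues_nonempty ν E Z hT) (OrderTop.bddAbove _)
  have hmem' : ∀ n, ∃ (T' : ℝ) (u : ℝ → ℝ³ → ℝ³) (t : ℝ), IsLerayHopfTrajectory ν T' u ∧
      eEnergy (u 0) ≤ E ∧ eWeakGradL2Sq (u 0) ≤ Z ∧ 0 ≤ t ∧ t ≤ T ∧ t < T' ∧
      z n = eWeakGradL2Sq (u t) := fun n => hmem n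
  choose T' u t h using hmem'
  refine ⟨T', u, t, fun n => (h n).1, fun n => (h n).2.1, fun n => (h n).2.2.1,
    fun n => ⟨(h n).2.2.2.1, (h n).2.2.2.2.1, (h n).2.2.2.2.2.1⟩, ?_⟩
  have hfun : (fun n => eWeakGradL2Sq (u n (t n))) = z := funext fun n => ((h n).2.2.2.2.2.2).symm
  rw [hfun]
  exact hz

/-! ## Composition -/

/-- **Composition over the stub STATEMENTS (real proof, closed).** The profile dichotomy (stub 1)
and attainment in the compact case (stub 2) give the crux `CompactnessDichotomy`: take a
maximising sequence (`exists_maximisingSeq`); in the compact branch apply stub 2 along the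
subsequence (a subsequence of a maximising sequence is maximising); in the gain branch the
`ε`-split subsequence `D` is maximising because its observed enstrophies are a subsequence of a
convergent sequence. -/
theorem CompactnessDichotomy_of_hyps
    (h₁ : ∀ ν : ℝ, 0 < ν → ∀ (E Z : ℝ≥0) (T : ℝ), 0 < E → 0 < Z → 0 < T →
      maxEnstrophy ν E Z T < ⊤ →
      ∀ (T' : ℕ → ℝ) (u : ℕ → ℝ → ℝ³ → ℝ³) (t : ℕ → ℝ),
        (∀ n, IsLerayHopfTrajectory ν (T' n) (u n)) → (∀ n, eEnergy (u n 0) ≤ E) →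
        (∀ n, eWeakGradL2Sq (u n 0) ≤ Z) → (∀ n, 0 ≤ t n ∧ t n ≤ T ∧ t n < T' n) →
        Tendsto (fun n => eWeakGradL2Sq (u n (t n))) atTop (𝓝 (maxEnstrophy ν E Z T)) →
        (∃ (σ : ℕ → ℕ) (x : ℕ → ℝ³) (ψ : ℝ³ → ℝ³), StrictMono σ ∧ MemLp ψ 2 volume ∧
            IsWeaklyDivFree ψ ∧ eEnergy ψ ≤ E ∧ eWeakGradL2Sq ψ ≤ Z ∧
            Tendsto (fun n => eWeakGradL2Sq (fun y => u (σ n) 0 (y + x n) - ψ y)) atTop (𝓝 0)) ∨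
        (∃ γ₀ : ℝ≥0, 0 < γ₀ ∧ ∀ ε : ℝ, 0 < ε →
            ∃ (J : ℕ) (D : ProfileSplitData J) (σ : ℕ → ℕ), StrictMono σ ∧
              IsProfileSplitSequence ν E Z T ε D ∧ (∀ n, D.u n = u (σ n) ∧ D.t n = t (σ n)) ∧
              ∀ j, eWeakGradL2Sq (D.φ j) + γ₀ ≤ Z))
    (h₂ : ∀ ν : ℝ, 0 < ν → ∀ (E Z : ℝ≥0) (T : ℝ), 0 < E → 0 < Z → 0 < T →
      maxEnstrophy ν E Z T < ⊤ →
      ∀ (T' : ℕ → ℝ) (u : ℕ → ℝ → ℝ³ → ℝ³) (t : ℕ → ℝ) (x : ℕ → ℝ³) (ψ : ℝ³ → ℝ³),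
        (∀ n, IsLerayHopfTrajectory ν (T' n) (u n)) → (∀ n, eEnergy (u n 0) ≤ E) →
        (∀ n, eWeakGradL2Sq (u n 0) ≤ Z) → (∀ n, 0 ≤ t n ∧ t n ≤ T ∧ t n < T' n) →
        Tendsto (fun n => eWeakGradL2Sq (u n (t n))) atTop (𝓝 (maxEnstrophy ν E Z T)) →
        MemLp ψ 2 volume → IsWeaklyDivFree ψ → eEnergy ψ ≤ E → eWeakGradL2Sq ψ ≤ Z →
        Tendsto (fun n => eWeakGradL2Sq (fun y => u n 0 (y + x n) - ψ y)) atTop (𝓝 0) →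
        IsMaxEnstrophyAttained ν E Z T) :
    CompactnessDichotomy := by
  intro ν hν E Z T hE hZ hT hfin
  obtain ⟨T', u, t, htraj, hEn, hZn, htn, hlim⟩ := exists_maximisingSeq ν E Z hT.le
  rcases h₁ ν hν E Z T hE hZ hT hfin T' u t htraj hEn hZn htn hlim with
    ⟨σ, x, ψ, hσ, hψ2, hψdiv, hψE, hψZ, hcpt⟩ | ⟨γ₀, hγ₀, hgain⟩
  · exact Or.inl (h₂ ν hν E Z T hE hZ hT hfin (fun n => T' (σ n)) (fun n => u (σ n))
      (fun n => t (σ n)) x ψ (fun n => htraj (σ n)) (fun n => hEn (σ n)) (fun n => hZn (σ n))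
      (fun n => htn (σ n)) (hlim.comp hσ.tendsto_atTop) hψ2 hψdiv hψE hψZ hcpt)
  · refine Or.inr ⟨γ₀, hγ₀, fun ε hε => ?_⟩
    obtain ⟨J, D, σ, hσ, hD, hsub, hg⟩ := hgain ε hε
    refine ⟨J, D, hD, ?_, hg⟩
    have hfun : (fun n => eWeakGradL2Sq (D.u n (D.t n))) =
        (fun n => eWeakGradL2Sq (u n (t n))) ∘ σ := by
      funext n
      simp only [Function.comp_apply, (hsub n).1, (hsub n).2]
    rw [hfun]
    exact hlim.comp hσ.tendsto_atTop

/-- **Birth composition (the skeleton theorem).** The crux `CompactnessDichotomy` BY NAME from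
the two registered stubs, used by name. No `Prop` hypotheses; no placeholder outside the stubs. -/
theorem CompactnessDichotomy_of :
    _root_.Summit.NavierStokesRegularity.NavierStokesRegularity.Theses.ExtremalEnstrophy.CompactnessDichotomy :=
  CompactnessDichotomy_of_hyps stub_profileDichotomy stub_compactAttained

end Summit.NavierStokesRegularity.NavierStokesRegularity.Cruxes.CompactnessDichotomy.Birth

end
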